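import Summits.BirchSwinnertonDyer.BirchSwinnertonDyer.Theorems.ManinLocalTwoThreeManinPrimeToAdditiveFiveLeStrongIsUnstarredOfAcrossIsogeny
import Summits.BirchSwinnertonDyer.BirchSwinnertonDyer.Theorems.ManinLocalTwoThreeManinPrimeToAdditiveFiveLeOrdinaryCornerOffTable
import Summits.BirchSwinnertonDyer.BirchSwinnertonDyer.Theorems.ManinLocalTwoThreeManinPrimeToAdditiveFiveLeSupersingularCornerTwistTransport
import Summits.BirchSwinnertonDyer.BirchSwinnertonDyer.Theorems.TwistFamilyManinDescentOrdinaryCornerOfSerreTateDepth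
import Summits.BirchSwinnertonDyer.BirchSwinnertonDyer.Theorems.TwistFamilyManinDescentRaynaudRegimeOfOrientation
import Summits.BirchSwinnertonDyer.BirchSwinnertonDyer.Theorems.TwistFamilyManinDescentCornerResidualOfSupersingularTransport
import Summits.BirchSwinnertonDyer.BirchSwinnertonDyer.Theorems.TwistFamilyManinDescentEisensteinResidualOfTrichotomy
import HarnessLib

/-!
# Route `ManinLocalTwoThree`, residual crux C5 `ManinPrimeToAdditiveFiveLe` (stmt-BirchSwinnertonDyer-22969), line `upper_anchor`
# (skeleton v13): **THE SEVEN LEAVES** — C5 BY NAME ⟸ seven cite-only prints ∧ K15a (27072) ∧ K15b (27071) ∧ I9 (27660) ∧ K18a″ (27661)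
# ∧ K18b″ (27662) ∧ C1 (25939) ∧ C2 (26929); and route `TwistFamilyManinDescent`'s residual R (25138) from THE SAME seven leaves

Lead seat bsd-line-ml23-c5-p1 (gen 7). After this generation's landings on the shared residual of the two decompositions of C5 — T17
`SupersingularCornerTwistTransport` (stmt-27551, p635594, this seat), `OrdinaryCornerOffTable` (stmt-27663, p636035, this seat), the glues
`CornerResidualOfSupersingularTransport` (stmt-27553, p634960) and `OrdinaryCornerOfSerreTateDepth` (stmt-27664, p635307) (seat bsd-line-ttd-p1 g9),
and the earlier closed glue `RaynaudRegimeOfOrientation` (stmt-27096) — every registered stub of skeleton v13 that is itself an assembled node of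
route `TwistFamilyManinDescent` unfolds BY NAME into that route's LEAVES. THEOREMS ONLY (ledger by name; no new mathematics):

* `maninPrimeToAdditiveFiveLe_of_sevenPrints_of_sevenLeaves` — **C5 BY NAME ⟸ {F″, ČNS, Cremona ≤ 5·10⁵, EdK, EdG, MazurJ, D–D} ∧ K15a ∧ K15b ∧ I9 ∧
  K18a″ ∧ K18b″ ∧ C1 ∧ C2**: the width seat's ψ §4 `maninPrimeToAdditiveFiveLe_of_sevenPrints_of_twistFamilyItems` with its `OrdinaryCornerManinResidual`
  (stmt-27552) input ASSEMBLED from the LINE-18R leaves (`TwistFamilyManinDescent.ordinaryCornerOfSerreTateDepth_proof` fed with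
  `ordinaryCornerOffTable_proof`).
* `eisensteinAdditiveManinResidual_of_fourPrints_of_sevenLeaves` — **TFMD's residual R `EisensteinAdditiveManinResidual` (stmt-25138) ⟸ {jTable, D–D,
  EdK, EdG} ∧ the SAME seven leaves**: pub/bsd-wall's `eisensteinAdditiveManinResidual_of_children` (p620618) with Ray57 ⟸ K15a ∧ K15b (glue 27096),
  Corner57 ⟸ T17 ∧ 27552 ∧ K15a ∧ Ray57 (glue 27553), 27552 ⟸ 18R leaves (glue 27664 + OffTable), CM163 closed (`cmCornerNotOrdinaryAtOneSixtyThree_proof`).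
So the two books of C5 now have IDENTICAL open leaves: {K15a, K15b} (potentially supersingular reducible rows at 5, 7: SS-Stevens orientation +
Edixhoven's Raynaud-regime print-extension), {I9, K18a″, K18b″} (potentially ordinary reducible corner at 5, 7: Serre–Tate-depth orientation +
Edixhoven dichotomy reader item + case-1 not-bottom), {C1, C2} (the `13`-locus: not-bottom + Stevens étale exit). HONEST STATUS: all seven leaves are
OPEN (five are orientation / Eisenstein laws beyond print, K15b and K18a″ are print-extension reader items); the prints are cite-only `def … : Prop`
(F″ referee-flagged; D–D's `_holds` under construction by seat bsd-line-ttd-p1). Nothing here proves any leaf, C5, R, Manin's conjecture or BSD.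

References: [EdixhovenManin1991] Thm. 3, Props. 7–9, §4; [Kato2004Asterisque] (8.1.3), Thm. 9.7; [CesnaviciusNeururerSaha2023] Thm. 1.2;
[Mazur1978] Thm. 1; [DokchitserDokchitser2015LocalInvariants] Thm. 5.1 (1); [Stevens1989] §2; [KostersPannekoek2017] Thm. 1.
-/

set_option autoImplicit false
-- the Theorems namespace of this sub repeats the summit name by design (D-0017 nested layout)
set_option linter.dupNamespace false

noncomputable section

open scoped Classical NumberField

namespace Summit.BirchSwinnertonDyer.BirchSwinnertonDyer.Theorems

open WeierstrassCurve Literature.NumberTheory.EllipticCurves Literature.NumberTheory.EllipticCurves.ModularForms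
  Summit.BirchSwinnertonDyer.Rank1Residual.ManinAdditive
  Summit.BirchSwinnertonDyer.BirchSwinnertonDyer.Theses.TwistFamilyManinDescent

/-- **C5 `ManinLocalTwoThree.ManinPrimeToAdditiveFiveLe` BY NAME ⟸ seven cite-only prints ∧ THE SEVEN LEAVES of route `TwistFamilyManinDescent`**:
K15a `SupersingularStrongIsUnstarred` (27072), K15b `SupersingularUnstarredStrongManinUnit` (27071), I9 `OrdinaryCornerOptimalSerreTateDeep` (27660),
K18a″ `OrdinaryCornerDeepEdixhovenDichotomy` (27661), K18b″ `OrdinaryCornerDeepUnstarredNotBottom` (27662), C1 `EisensteinOrdinaryTwistLatticeNotBottom`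
(25939), C2 `EisensteinOrdinaryStrongIsTop` (26929). Conditional result (`--supports`, helper); every leaf is OPEN, every print cite-only.
[cite: EdixhovenManin1991, Thm. 3 and §4] [cite: Kato2004Asterisque, (8.1.3) and Thm. 9.7] [cite: DokchitserDokchitser2015LocalInvariants, Thm. 5.1 (1)] -/
theorem maninPrimeToAdditiveFiveLe_of_sevenPrints_of_sevenLeaves
    (hK57 : kato_neron_isIntegral_twistedSymbolSum_of_additive_five_le)
    (hCNS : cesnaviciusNeururerSaha_padicVal_maninConstant_le_modularDegree)
    (h500k : cremona_abs_maninConstant_eq_one_of_level_le_500000)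
    (hEdK : edixhoven_not_dvd_maninConstant_of_kodairaSymbol_ne)
    (hEdG : edixhoven_not_dvd_maninConstant_of_not_potentiallyGoodOrdinary)
    (hJ : mazur_j_mem_of_not_hasIrreducibleModPGaloisRep_of_eleven_le)
    (hDD : dokchitser_padicValInt_minimalDiscriminantInt_eq_of_isogeny_of_potentiallyGoodOrdinary)
    (hK15a : SupersingularStrongIsUnstarred) (hK15b : SupersingularUnstarredStrongManinUnit)
    (hI9 : OrdinaryCornerOptimalSerreTateDeep) (hKa : OrdinaryCornerDeepEdixhovenDichotomy)
    (hKb : OrdinaryCornerDeepUnstarredNotBottom)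
    (hC1 : EisensteinOrdinaryTwistLatticeNotBottom) (hC2 : EisensteinOrdinaryStrongIsTop) :
    Summit.BirchSwinnertonDyer.BirchSwinnertonDyer.Theses.ManinLocalTwoThree.ManinPrimeToAdditiveFiveLe :=
  maninPrimeToAdditiveFiveLe_of_sevenPrints_of_twistFamilyItems hK57 hCNS h500k hEdK hEdG hJ hDD hK15b
    (TwistFamilyManinDescent.ordinaryCornerOfSerreTateDepth_proof hI9 hKa hKb ordinaryCornerOffTable_proof) hK15a hC1 hC2

/-- **Route `TwistFamilyManinDescent`'s residual R `EisensteinAdditiveManinResidual` (stmt-25138) ⟸ four cite-only prints (Mazur–Kenku `j`-table,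
D–D 2015 Thm. 5.1 (1), Edixhoven 1991 Thm. 3 in both forms) ∧ THE SAME SEVEN LEAVES** — pub/bsd-wall's dispatch
`EisensteinTrichotomy.eisensteinAdditiveManinResidual_of_children` (p620618) with every assembled child unfolded: Ray57 ⟸ K15a ∧ K15b (glue 27096),
Corner57 ⟸ T17 (THEOREM, p635594) ∧ 27552 ∧ K15a ∧ Ray57 (glue 27553), 27552 ⟸ I9 ∧ K18a″ ∧ K18b″ ∧ OffTable (THEOREM, p636035) (glue 27664),
CM163 closed. Conditional result (`--supports`, helper). [cite: Mazur1978, Thm. 1] [cite: DokchitserDokchitser2015LocalInvariants, Thm. 5.1 (1)]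
[cite: EdixhovenManin1991, Thm. 3] -/
theorem eisensteinAdditiveManinResidual_of_fourPrints_of_sevenLeaves
    (hT : primeDegreeIsogeny_jTable)
    (hDD : dokchitser_padicValInt_minimalDiscriminantInt_eq_of_isogeny_of_potentiallyGoodOrdinary)
    (hEdK : edixhoven_not_dvd_maninConstant_of_kodairaSymbol_ne)
    (hEdG : edixhoven_not_dvd_maninConstant_of_not_potentiallyGoodOrdinary)
    (hK15a : SupersingularStrongIsUnstarred) (hK15b : SupersingularUnstarredStrongManinUnit)
    (hI9 : OrdinaryCornerOptimalSerreTateDeep) (hKa : OrdinaryCornerDeepEdixhovenDichotomy)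
    (hKb : OrdinaryCornerDeepUnstarredNotBottom)
    (hC1 : EisensteinOrdinaryTwistLatticeNotBottom) (hC2 : EisensteinOrdinaryStrongIsTop) :
    EisensteinAdditiveManinResidual :=
  have hRay : EisensteinRaynaudRegimeManinUnit := TwistFamilyManinDescent.raynaudRegimeOfOrientation_proof hK15a hK15b
  have hOrd : OrdinaryCornerManinResidual :=
    TwistFamilyManinDescent.ordinaryCornerOfSerreTateDepth_proof hI9 hKa hKb ordinaryCornerOffTable_proof
  TwistFamilyManinDescent.EisensteinTrichotomy.eisensteinAdditiveManinResidual_of_children hT hDD hC1 hC2 ⟨hEdK, hEdG⟩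
    TwistFamilyManinDescent.cmCornerNotOrdinaryAtOneSixtyThree_proof hRay
    (TwistFamilyManinDescent.cornerResidualOfSupersingularTransport_proof supersingularCornerTwistTransport_proof hOrd hK15a hRay)

end Summit.BirchSwinnertonDyer.BirchSwinnertonDyer.Theorems

end
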